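import Summits.RiemannHypothesis.RiemannHypothesis.Theses.SpectralTrace
import Summits.RiemannHypothesis.RiemannHypothesis.Theorems.WindowStep.Negative.Collapse
import Summits.RiemannHypothesis.RiemannHypothesis.Theorems.WindowStep.Negative.Nested
import Summits.RiemannHypothesis.RiemannHypothesis.Theorems.WindowStep.Negative.FiniteMoves
import Summits.RiemannHypothesis.RiemannHypothesis.Theorems.WindowStep.Negative.LoadBearing
import Summits.RiemannHypothesis.RiemannHypothesis.Theorems.WindowStep.Negative.ExpSumUniqueness
import Summits.RiemannHypothesis.RiemannHypothesis.Theorems.WindowStep.Negative.BothWays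
import HarnessLib

/-!
# Disproof of `WindowStep` — findings (cdisprove seat, cycle 1, 2026-08-16)

Crux `stmt-RiemannHypothesis-14659`:
`WindowStep := ∀ n ≥ 2, Trace(log n) → Trace(log (n+1))`, where
`Trace(A) := ∃ (ι : Type) (γ : ι → ℝ), ∀ Weil tests g with tsupport g ⊆ [-A, A],
HasSum (i ↦ ĝ(1/2 + iγ_i)) (W g)` (the collar-healing STEP of route SpectralTrace's ladder).

## VERDICT: no unconditional kill exists short of `¬RH`
`¬ WindowStep ↔ (WindowTraceArch ∧ ¬ RiemannHypothesis)` (`Negative/Collapse.lean`, landed):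
`RH → WindowStep` (the zero ordinates serve every rung) and `¬WindowTraceArch → WindowStep`
(vacuously: every rung contains the seed). So a refutation of this crux = a disproof of RH that
ALSO proves the archimedean seed. Everything below is therefore NEGATIVE KNOWLEDGE FOR THE
PROVERS — what a proof of the step can and cannot look like — all kernel-checked, sorry-free
unless marked NEAR-MISS, axioms `propext / Classical.choice / Quot.sound`.

## Index of findings (section → landed module)
* §0 Why it resists — `Negative/Collapse.lean` (earlier refuter): `WindowStep ↔ (Arch → RH)`.
* §1 LOAD-BEARING binders — `Negative/LoadBearing.lean` (this seat):
  (H1) drop `2 ≤ n` ⇒ the statement becomes RH itself (rungs `n = 0, 1` are free: `log 0 =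
  log 1 = 0`, the zero test only; the instance `n = 1` is the seed). The binder is worth exactly
  `WindowTraceArch`. (H2) drop the rung hypothesis ⇒ the ladder = RH. (H3) drop the window in the
  CONCLUSION (ask for the full thesis `X` at once) ⇒ NOTHING changes: "one rung at a time" is
  logically idle (`windowJump_iff_windowStep`). (H4) realness of `γ` / `IsWeilTest`: see
  `SpectralThesis/Negative/LoadBearing.lean`, `WindowTraceArch/Negative/WithoutIsWeilTest.lean`.
* §2 RIGIDITY OF HEALING (what "moving/adding atoms" cannot be) — `Negative/Nested.lean`,
  `Negative/FiniteMoves.lean` (this seat), unconditional, no arithmetic input, any window: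
  a rung-`B` family is NEVER obtained from a rung-`A` family (`A ≤ B`) that is not itself rung-`B`
  by (a) adding atoms only, (b) deleting atoms only, (c) relocating finitely many atoms,
  (d) any modification confined to the atoms below a finite height (local finiteness makes it
  finite). Every genuine step `n → n+1` removes AND adds atoms, infinitely many, at unbounded
  heights. Core lemma: exponential-sum uniqueness from window tests
  (`multiset_eq_of_sum_weilMellin_eq`). Consistent with (not contradicting) the line's far-field
  displacement picture `δ(γ) ~ sin(γ log m)/log γ` (bounded, NOT finitely supported, not → a
  permutation); an `ℓ¹`/`→ 0` displacement no-go is NOT claimed (believed false: frame synthesis).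
* §2' THE DEFECT IS AN HONEST OBJECT — `Negative/DefectTools.lean` (this seat, p93996): for a
  rung-`A` family and ANY Weil test `g` (any support) `Σ_i ‖ĝ(1/2+iγ_i)‖ < ∞`
  (`summable_norm_weilMellin_of_windowTrace`: local Weyl count × cell decay), so the collar
  defect `g ↦ W(g) − Σ'_i ĝ(1/2+iγ_i)` of the crux text is a well-defined functional vanishing on
  the window (`windowDefect_eq_zero`) — the unconditional half of the line's `CollarDefect`.
* §3 THE PLANNER'S KILL (iv) IS RH-ENTANGLED: "rung-(n+1) families are never bounded
  displacements of rung-n families" (`EngineKill`) is FALSE under RH (displacement `0`) and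
  vacuously TRUE under `¬WindowTraceArch`; so `EngineKill → ¬RH`: the re-plan trigger can only
  fire with a disproof of RH in hand (`not_riemannHypothesis_of_engineKill`).
* §4 LINE `Sketch` (picked): stubs `densityForm` / `cutoffInvariance` / `highZone` LANDED
  (p88714 / p88425 / p88418); held `stub_windowGrowth` ≡ RH given the three (lead's
  `windowGrowth_iff_riemannHypothesis`, p88467); composition `WindowStep_of` kernel-checked. No
  stub is attackable short of `¬RH`; no stub is mis-typed (cutoff `weilPrimeIndex (log(n+1)/2)`
  on both sides is consistent by `stub_cutoffInvariance`). Targets: none (stuck_stubs = []).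
* §5 BOTH WAYS — `Negative/ExpSumUniqueness.lean`, `Negative/BothWays.lean` (this seat):
  finitely many removals plus ARBITRARILY many additions still force a re-indexing (the decay
  `‖ĝ(1/2+iv)‖ ≤ C_g/(1+v²)` bounds the far additions, local finiteness makes them finite, then
  exponential-sum uniqueness): `step_not_by_cofinite_matching`; and quantitatively every genuine
  step leaves INFINITELY many atoms of the old family unmatched (`step_infinite_unmatched`) AND
  brings in infinitely many new ones (`step_infinite_unadded`).
  And with re-indexing: `Negative/BelowHeight.lean` (p94197) — if the atoms of height `> R` of
  EITHER family are matched injectively into the other, there is no step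
  (`no_windowStep_of_matched_above_height`, `…'`): a frozen tail with an arbitrarily re-worked
  finite bottom block never performs the step. Near-misses: none open at the end of cycle 1.

## §6 Expected next, NOT kernel-checked (literature pointers for the provers)
The signed measure `ν = Σ δ_{γ'_j} − Σ δ_{γ_i}` (new minus old family) is Poisson-finite
(local counts `O(log T)`, `LocalWeyl`) and has the SPECTRAL GAP `(−log n, log n)` (both families
serve rung `n`). Gap theorems then constrain the SET of moved positions `X = supp ν`, far beyond
§2/§5: Beurling's gap theorem (no "long gaps" in `X`) and Poltoratski's gap formula
[doi:10.1007/s11511-012-0076-4, Acta Math. 208 (2012); Mitkovski–Poltoratski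
doi:10.1016/j.aim.2009.12.014] give `X ⊇` a `d`-uniform sequence with `2πd ≥ 2 log n`, i.e. the
moved positions have interior density `≥ (log n)/π` at ALL heights — against the total density
`(1/2π) log(T/2π)` of a rung family this says: below height `T ≍ 2πn` essentially every atom
moves, and at height `T` at least the fraction `≍ log n / log T` does (each moved atom counted at
its old and new position). This matches the line's far-field law `δ(γ) ~ sin(γ log m)/log γ`
(non-zero everywhere) and the route's capacity height `2πe^{2A}`; the finite-measure hypothesis
of the cited theorems needs the standard Poisson-finite reduction. Formalising Beurling's gap
theorem is out of reach this cycle; recorded as the sharp form of "non-locality of the step".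

## Dead ends (do not retry)
* Any `∀ rung-n family …` strengthening (uniqueness, locality, same-family step) is vacuous
  without a rung family, and constructing one proves `WindowTraceArch` (open, RH-implied).
* Small-model / decide: no finite or decidable shadow — a rung family is infinite
  (`WindowTraceArch/Negative/FiniteSpectrum.lean`) with local density `≍ log T` (`LocalWeyl`).
-/

set_option linter.dupNamespace false

noncomputable section

open Complex Set

namespace Summit.RiemannHypothesis.RiemannHypothesis.Cruxes.WindowStep.Disproof

open Literature.NumberTheory.LFunctions
open Summit.RiemannHypothesis.RiemannHypothesis.Theses.SpectralTrace
open Summit.RiemannHypothesis.RiemannHypothesis.Theorems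
open Summit.RiemannHypothesis.RiemannHypothesis.Theorems.WindowStep.Negative

/-- `Trace(A)` (file-local notation, as in `Collapse.lean`). -/
local notation3 "WTrace " A:max => ∃ (ι : Type) (γ : ι → ℝ), ∀ g : ℝ → ℂ, IsWeilTest g →
  tsupport g ⊆ Set.Icc (-A) A →
    HasSum (fun i => weilMellin g (1 / 2 + (γ i : ℂ) * I)) (weilFunctional g)

/-! ## §0 Why the crux resists refutation -/

/-- RH proves the step (every rung is served by the zero ordinates). [folklore] -/
theorem windowStep_of_riemannHypothesis (hRH : _root_.RiemannHypothesis) : WindowStep :=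
  windowStep_iff_windowTraceArch_imp_riemannHypothesis.2 fun _ => hRH

/-- Without the seed the step holds vacuously (every rung contains the seed). [folklore] -/
theorem windowStep_of_not_windowTraceArch (hA : ¬ WindowTraceArch) : WindowStep :=
  windowStep_iff_windowTraceArch_imp_riemannHypothesis.2 fun h => absurd h hA

/-- A refutation of the crux is exactly `WindowTraceArch ∧ ¬RH`. [folklore] -/
theorem not_windowStep_iff' : ¬ WindowStep ↔ (WindowTraceArch ∧ ¬ _root_.RiemannHypothesis) :=
  not_windowStep_iff

/-- In particular any disproof of this crux disproves RH. [folklore] -/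
theorem not_riemannHypothesis_of_not_windowStep' (h : ¬ WindowStep) :
    ¬ _root_.RiemannHypothesis :=
  not_riemannHypothesis_of_not_windowStep h

/-! ## §1 Load-bearing analysis (mutated statements, located exactly) -/

/-- The crux with the binder `2 ≤ n` dropped. -/
def WindowStepWithoutTwoLe : Prop :=
  ∀ n : ℕ, (WTrace (Real.log (n : ℝ))) → WTrace (Real.log ((n : ℝ) + 1))

/-- (H1) Without `2 ≤ n` the crux IS the Riemann Hypothesis. [folklore] -/
theorem windowStepWithoutTwoLe_iff_riemannHypothesis :
    WindowStepWithoutTwoLe ↔ _root_.RiemannHypothesis :=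
  windowStep_without_two_le_iff_riemannHypothesis

/-- (H1, `_false_without_` shape — necessarily conditional) any proof of the crux that does not
use `2 ≤ n` proves RH; equivalently `¬RH` kills the mutant. [folklore] -/
theorem windowStep_false_without_twoLe_of_not_riemannHypothesis
    (h : ¬ _root_.RiemannHypothesis) : ¬ WindowStepWithoutTwoLe :=
  fun hW => h (windowStepWithoutTwoLe_iff_riemannHypothesis.1 hW)

/-- The gap between the crux and its (H1)-mutant is exactly `¬Arch ∧ ¬RH`. [folklore] -/
theorem windowStep_and_not_withoutTwoLe_iff :
    (WindowStep ∧ ¬ WindowStepWithoutTwoLe) ↔ (¬ WindowTraceArch ∧ ¬ _root_.RiemannHypothesis) := by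
  rw [windowStepWithoutTwoLe_iff_riemannHypothesis,
    windowStep_iff_windowTraceArch_imp_riemannHypothesis]
  tauto

/-- The crux with the rung hypothesis dropped (bare conclusion). -/
def WindowStepWithoutRung : Prop :=
  ∀ n : ℕ, 2 ≤ n → WTrace (Real.log ((n : ℝ) + 1))

/-- (H2) Without the rung hypothesis the crux is the ladder, i.e. RH. [folklore] -/
theorem windowStepWithoutRung_iff_riemannHypothesis :
    WindowStepWithoutRung ↔ _root_.RiemannHypothesis :=
  windowStep_without_rung_iff_riemannHypothesis

/-- The crux with the WINDOW OF THE CONCLUSION dropped (ask for the whole thesis `X`). -/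
def WindowJump : Prop :=
  ∀ n : ℕ, 2 ≤ n → (WTrace (Real.log (n : ℝ))) → SpectralThesis

/-- (H3) The window in the conclusion is idle: `WindowJump ↔ WindowStep`. [folklore] -/
theorem windowJump_iff_windowStep' : WindowJump ↔ WindowStep :=
  windowJump_iff_windowStep

/-! ## §2 Rigidity of healing — the step instances (`A = log n`, `B = log (n+1)`) -/

/-- (a) No step by pure ADDITION of atoms. [folklore] -/
theorem step_not_by_extension {n : ℕ} (hn : 2 ≤ n) {ι ι' : Type*} {γ : ι → ℝ} {γ' : ι' → ℝ}
    {e : ι → ι'} (he : Function.Injective e) (hext : ∀ i, γ' (e i) = γ i)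
    (hn_fam : ∀ g : ℝ → ℂ, IsWeilTest g →
      tsupport g ⊆ Icc (-Real.log (n : ℝ)) (Real.log (n : ℝ)) →
        HasSum (fun i => weilMellin g (1 / 2 + (γ i : ℂ) * I)) (weilFunctional g))
    (hnot : ¬ ∀ g : ℝ → ℂ, IsWeilTest g →
      tsupport g ⊆ Icc (-Real.log ((n : ℝ) + 1)) (Real.log ((n : ℝ) + 1)) →
        HasSum (fun i => weilMellin g (1 / 2 + (γ i : ℂ) * I)) (weilFunctional g)) :
    ¬ ∀ g : ℝ → ℂ, IsWeilTest g →
      tsupport g ⊆ Icc (-Real.log ((n : ℝ) + 1)) (Real.log ((n : ℝ) + 1)) →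
        HasSum (fun j => weilMellin g (1 / 2 + (γ' j : ℂ) * I)) (weilFunctional g) :=
  no_windowStep_by_extension (log_rung_pos_and_le hn).1 (log_rung_pos_and_le hn).2 he hext
    hn_fam hnot

/-- (b) No step by pure DELETION of atoms. [folklore] -/
theorem step_not_by_deletion {n : ℕ} (hn : 2 ≤ n) {ι : Type*} {γ : ι → ℝ} (S : Set ι)
    (hn_fam : ∀ g : ℝ → ℂ, IsWeilTest g →
      tsupport g ⊆ Icc (-Real.log (n : ℝ)) (Real.log (n : ℝ)) →
        HasSum (fun i => weilMellin g (1 / 2 + (γ i : ℂ) * I)) (weilFunctional g))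
    (hnot : ¬ ∀ g : ℝ → ℂ, IsWeilTest g →
      tsupport g ⊆ Icc (-Real.log ((n : ℝ) + 1)) (Real.log ((n : ℝ) + 1)) →
        HasSum (fun i => weilMellin g (1 / 2 + (γ i : ℂ) * I)) (weilFunctional g)) :
    ¬ ∀ g : ℝ → ℂ, IsWeilTest g →
      tsupport g ⊆ Icc (-Real.log ((n : ℝ) + 1)) (Real.log ((n : ℝ) + 1)) →
        HasSum (fun i : S => weilMellin g (1 / 2 + (γ i : ℂ) * I)) (weilFunctional g) :=
  no_windowStep_by_deletion (log_rung_pos_and_le hn).1 (log_rung_pos_and_le hn).2 S hn_fam hnot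

/-- (c) No step by FINITELY MANY moves. [folklore] -/
theorem step_not_by_finite_moves {n : ℕ} (hn : 2 ≤ n) {ι : Type*} {γ γ' : ι → ℝ}
    (F : Finset ι) (hF : ∀ i ∉ F, γ' i = γ i)
    (hn_fam : ∀ g : ℝ → ℂ, IsWeilTest g →
      tsupport g ⊆ Icc (-Real.log (n : ℝ)) (Real.log (n : ℝ)) →
        HasSum (fun i => weilMellin g (1 / 2 + (γ i : ℂ) * I)) (weilFunctional g))
    (hnot : ¬ ∀ g : ℝ → ℂ, IsWeilTest g →
      tsupport g ⊆ Icc (-Real.log ((n : ℝ) + 1)) (Real.log ((n : ℝ) + 1)) →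
        HasSum (fun i => weilMellin g (1 / 2 + (γ i : ℂ) * I)) (weilFunctional g)) :
    ¬ ∀ g : ℝ → ℂ, IsWeilTest g →
      tsupport g ⊆ Icc (-Real.log ((n : ℝ) + 1)) (Real.log ((n : ℝ) + 1)) →
        HasSum (fun i => weilMellin g (1 / 2 + (γ' i : ℂ) * I)) (weilFunctional g) :=
  no_windowStep_by_finite_moves (log_rung_pos_and_le hn).1 (log_rung_pos_and_le hn).2 F hF
    hn_fam hnot

/-- (d) No step BELOW ANY FINITE HEIGHT `R`. [folklore] -/
theorem step_not_below_height {n : ℕ} (hn : 2 ≤ n) {ι : Type*} {γ γ' : ι → ℝ} (R : ℝ)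
    (hR : ∀ i, R < |γ i| → γ' i = γ i)
    (hn_fam : ∀ g : ℝ → ℂ, IsWeilTest g →
      tsupport g ⊆ Icc (-Real.log (n : ℝ)) (Real.log (n : ℝ)) →
        HasSum (fun i => weilMellin g (1 / 2 + (γ i : ℂ) * I)) (weilFunctional g))
    (hnot : ¬ ∀ g : ℝ → ℂ, IsWeilTest g →
      tsupport g ⊆ Icc (-Real.log ((n : ℝ) + 1)) (Real.log ((n : ℝ) + 1)) →
        HasSum (fun i => weilMellin g (1 / 2 + (γ i : ℂ) * I)) (weilFunctional g)) :
    ¬ ∀ g : ℝ → ℂ, IsWeilTest g →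
      tsupport g ⊆ Icc (-Real.log ((n : ℝ) + 1)) (Real.log ((n : ℝ) + 1)) →
        HasSum (fun i => weilMellin g (1 / 2 + (γ' i : ℂ) * I)) (weilFunctional g) :=
  no_windowStep_below_height (log_rung_pos_and_le hn).1 (log_rung_pos_and_le hn).2 R hR
    hn_fam hnot

/-! ## §3 Natural strengthenings and the planner's kill criterion (iv) -/

/-- The route's ENGINE KILL (iv): "rung-(n+1) families are never bounded-displacement
modifications of rung-n families" (same index type, sup displacement `≤ D`). -/
def EngineKill : Prop :=
  ∀ n : ℕ, 2 ≤ n → ∀ (ι : Type) (γ γ' : ι → ℝ) (D : ℝ),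
    (∀ g : ℝ → ℂ, IsWeilTest g → tsupport g ⊆ Icc (-Real.log (n : ℝ)) (Real.log (n : ℝ)) →
      HasSum (fun i => weilMellin g (1 / 2 + (γ i : ℂ) * I)) (weilFunctional g)) →
    (∀ g : ℝ → ℂ, IsWeilTest g →
      tsupport g ⊆ Icc (-Real.log ((n : ℝ) + 1)) (Real.log ((n : ℝ) + 1)) →
        HasSum (fun i => weilMellin g (1 / 2 + (γ' i : ℂ) * I)) (weilFunctional g)) →
    (∀ i, |γ' i - γ i| ≤ D) → False

/-- Under RH kill (iv) FAILS: the zero ordinates serve both rungs with displacement `0`.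
[folklore] -/
theorem not_engineKill_of_riemannHypothesis (hRH : _root_.RiemannHypothesis) : ¬ EngineKill := by
  intro hK
  obtain ⟨ι, γ, hγ⟩ := spectralThesis_of_riemannHypothesis hRH
  exact hK 2 le_rfl ι γ γ 0 (fun g hg _ => hγ g hg) (fun g hg _ => hγ g hg)
    fun i => by simp

/-- Hence MEETING kill (iv) is a disproof of RH. [folklore] -/
theorem not_riemannHypothesis_of_engineKill (hK : EngineKill) : ¬ _root_.RiemannHypothesis :=
  fun hRH => not_engineKill_of_riemannHypothesis hRH hK

/-- And without the seed kill (iv) holds VACUOUSLY (a rung-n family contains the seed).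
[folklore] -/
theorem engineKill_of_not_windowTraceArch (hA : ¬ WindowTraceArch) : EngineKill := by
  intro n hn ι γ _ _ hγ _ _
  exact hA (seed_of_rung hn ⟨ι, γ, hγ⟩)

/-- The natural strengthening "finitely many moves suffice at some prime-power rung" is refuted
outright by §2(c): for EVERY `n ≥ 2`, a finite relocation of a rung-n family that is not yet a
rung-(n+1) family is never a rung-(n+1) family (restated as a closed negative). [folklore] -/
theorem not_exists_finite_step :
    ¬ ∃ (n : ℕ) (_ : 2 ≤ n) (ι : Type) (γ γ' : ι → ℝ) (F : Finset ι),
      (∀ i ∉ F, γ' i = γ i) ∧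
      (∀ g : ℝ → ℂ, IsWeilTest g → tsupport g ⊆ Icc (-Real.log (n : ℝ)) (Real.log (n : ℝ)) →
        HasSum (fun i => weilMellin g (1 / 2 + (γ i : ℂ) * I)) (weilFunctional g)) ∧
      (¬ ∀ g : ℝ → ℂ, IsWeilTest g →
        tsupport g ⊆ Icc (-Real.log ((n : ℝ) + 1)) (Real.log ((n : ℝ) + 1)) →
          HasSum (fun i => weilMellin g (1 / 2 + (γ i : ℂ) * I)) (weilFunctional g)) ∧
      (∀ g : ℝ → ℂ, IsWeilTest g →
        tsupport g ⊆ Icc (-Real.log ((n : ℝ) + 1)) (Real.log ((n : ℝ) + 1)) →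
          HasSum (fun i => weilMellin g (1 / 2 + (γ' i : ℂ) * I)) (weilFunctional g)) := by
  rintro ⟨n, hn, ι, γ, γ', F, hF, hγ, hnot, hγ'⟩
  exact step_not_by_finite_moves hn F hF hγ hnot hγ'

/-! ## §5 Both ways: finitely many removals plus ANY additions (landed `Negative/BothWays.lean`) -/

/-- (e) No step by finitely many REMOVALS plus arbitrarily many ADDITIONS: if `γ'` contains a
copy of the rung-`n` family `γ` minus finitely many atoms `F` (an injection
`e : {i // i ∉ F} → ι'` with `γ' ∘ e = γ`) and `γ` is not a rung-`(n+1)` family, then `γ'` is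
not a rung-`(n+1)` family. [folklore] -/
theorem step_not_by_cofinite_matching {n : ℕ} (hn : 2 ≤ n) {ι ι' : Type*} {γ : ι → ℝ}
    {γ' : ι' → ℝ} (F : Finset ι) {e : {i // i ∉ F} → ι'} (he : Function.Injective e)
    (hext : ∀ i, γ' (e i) = γ i)
    (hn_fam : ∀ g : ℝ → ℂ, IsWeilTest g →
      tsupport g ⊆ Icc (-Real.log (n : ℝ)) (Real.log (n : ℝ)) →
        HasSum (fun i => weilMellin g (1 / 2 + (γ i : ℂ) * I)) (weilFunctional g))
    (hnot : ¬ ∀ g : ℝ → ℂ, IsWeilTest g →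
      tsupport g ⊆ Icc (-Real.log ((n : ℝ) + 1)) (Real.log ((n : ℝ) + 1)) →
        HasSum (fun i => weilMellin g (1 / 2 + (γ i : ℂ) * I)) (weilFunctional g)) :
    ¬ ∀ g : ℝ → ℂ, IsWeilTest g →
      tsupport g ⊆ Icc (-Real.log ((n : ℝ) + 1)) (Real.log ((n : ℝ) + 1)) →
        HasSum (fun j => weilMellin g (1 / 2 + (γ' j : ℂ) * I)) (weilFunctional g) :=
  no_windowStep_by_cofinite_matching (log_rung_pos_and_le hn).1 (log_rung_pos_and_le hn).2 F he
    hext hn_fam hnot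

/-- (f) Quantitatively: if the rung-`(n+1)` family `γ'` is matched with the rung-`n` family `γ`
(not itself rung-`(n+1)`) along an injection `e : S → ι'` intertwining the atoms, then the
unmatched old atoms `Sᶜ` are INFINITELY many. [folklore] -/
theorem step_infinite_unmatched {n : ℕ} (hn : 2 ≤ n) {ι ι' : Type*} {γ : ι → ℝ}
    {γ' : ι' → ℝ} (S : Set ι) {e : S → ι'} (he : Function.Injective e)
    (hext : ∀ i : S, γ' (e i) = γ i)
    (hn_fam : ∀ g : ℝ → ℂ, IsWeilTest g →
      tsupport g ⊆ Icc (-Real.log (n : ℝ)) (Real.log (n : ℝ)) →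
        HasSum (fun i => weilMellin g (1 / 2 + (γ i : ℂ) * I)) (weilFunctional g))
    (hnot : ¬ ∀ g : ℝ → ℂ, IsWeilTest g →
      tsupport g ⊆ Icc (-Real.log ((n : ℝ) + 1)) (Real.log ((n : ℝ) + 1)) →
        HasSum (fun i => weilMellin g (1 / 2 + (γ i : ℂ) * I)) (weilFunctional g))
    (hsucc : ∀ g : ℝ → ℂ, IsWeilTest g →
      tsupport g ⊆ Icc (-Real.log ((n : ℝ) + 1)) (Real.log ((n : ℝ) + 1)) →
        HasSum (fun j => weilMellin g (1 / 2 + (γ' j : ℂ) * I)) (weilFunctional g)) :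
    Sᶜ.Infinite :=
  infinite_unmatched_of_windowStep (log_rung_pos_and_le hn).1 (log_rung_pos_and_le hn).2 S he
    hext hn_fam hnot hsucc

/-- (f') And the other direction: along any partial matching `e' : S' → ι` of NEW indices into
the old family (`γ ∘ e' = γ'` on `S'`), the unmatched new atoms `S'ᶜ` are INFINITELY many.
[folklore] -/
theorem step_infinite_unadded {n : ℕ} (hn : 2 ≤ n) {ι ι' : Type*} {γ : ι → ℝ}
    {γ' : ι' → ℝ} (S' : Set ι') {e' : S' → ι} (he' : Function.Injective e')
    (hext' : ∀ j : S', γ (e' j) = γ' j)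
    (hn_fam : ∀ g : ℝ → ℂ, IsWeilTest g →
      tsupport g ⊆ Icc (-Real.log (n : ℝ)) (Real.log (n : ℝ)) →
        HasSum (fun i => weilMellin g (1 / 2 + (γ i : ℂ) * I)) (weilFunctional g))
    (hnot : ¬ ∀ g : ℝ → ℂ, IsWeilTest g →
      tsupport g ⊆ Icc (-Real.log ((n : ℝ) + 1)) (Real.log ((n : ℝ) + 1)) →
        HasSum (fun i => weilMellin g (1 / 2 + (γ i : ℂ) * I)) (weilFunctional g))
    (hsucc : ∀ g : ℝ → ℂ, IsWeilTest g →
      tsupport g ⊆ Icc (-Real.log ((n : ℝ) + 1)) (Real.log ((n : ℝ) + 1)) →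
        HasSum (fun j => weilMellin g (1 / 2 + (γ' j : ℂ) * I)) (weilFunctional g)) :
    S'ᶜ.Infinite :=
  infinite_unadded_of_windowStep (log_rung_pos_and_le hn).1 (log_rung_pos_and_le hn).2 S' he'
    hext' hn_fam hnot hsucc

end Summit.RiemannHypothesis.RiemannHypothesis.Cruxes.WindowStep.Disproof

end
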